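import Literature.Probability.MarkovChains.ProjectedChain
import Literature.Probability.MarkovChains.BottleneckRatio

/-!
HONEST FRAMING: exact (Metropolis-corrected) sampling algorithms for lattice gauge theory; figures
of merit are autocorrelation/cost numbers at stated couplings and volumes; no continuum-physics
claim.

# UntouchedReplicas — THE GENEALOGICAL AUGMENTATION: A CHAIN OF LOCAL MOVES ON `L → S`, TAGGED WITH THE SET OF
# COORDINATES NO MOVE HAS YET PROPOSED, LUMPS ONTO THE CHAIN ITSELF AND ONTO AN AUTONOMOUS "TOUCH CHAIN" ON SUBSETS;
# FROM A POINT MASS AT `x`, THE MASS OF `{z : z_k ≠ x_k ∀ k ∈ T}` AT TIME `n` IS AT MOST THE TOUCH CHAIN'S MASS AT `∅`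
# (lean-2 GEN-24, ours)

Venture-side (OURS).  Cell `lqcd-flow` (pub-lqcd), unit `pub-lqcd-lean-2-g24`, 2026-08-27.  Chapter L (the coupon-collector
law from a cold start), file 1: the path-space event "coordinate `k` has not been proposed by time `n`" rendered WITHOUT
a trajectory space, as a lumping.  Everything is stated for an ABSTRACT mixture of local moves, through hypotheses that
are equations (no definitions): a finite type `ι` of move types with weights `c ≥ 0`, `Σ c = 1`, row-stochastic kernels
`Pm a` on the configurations `L → S` and "touched sets" `τ a ⊆ L`, LOCAL in the sense `k ∉ τ a, Pm a y z ≠ 0 ⇒ z_k = y_k`;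
the chain `P = Σ_a c_a·Pm a`; the TOUCH CHAIN `R(U,V) = Σ_a c_a·𝟙{V = U ∖ τ a}` on `Finset L`; the AUGMENTED CHAIN
`P̂((y,U),(z,V)) = Σ_a c_a·Pm a(y,z)·𝟙{V = U ∖ τ a}` on `(L → S) × Finset L`.  The exchange schemes of chapters G–K are
such mixtures (entry `r` of the swap list, weight `t/m`, touching its two endpoints; level update `k`, weight
`(1−t)w_k`, touching `{k}`) — the sequel instantiates.

## What is proved

* §1 `mixture_isRowStochastic`, `touch_isRowStochastic`, `aug_isRowStochastic`; the two LUMPING IDENTITIES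
  **`aug_lump_fst`** (`Σ_V P̂((y,U),(z,V)) = P(y,z)`) and **`aug_lump_snd`** (`Σ_z P̂((y,U),(z,V)) = R(U,V)`), in the
  form consumed by `Literature/…/ProjectedChain` (Levin–Peres–Wilmer Lemma 2.5); hence **`aug_lawAt_fst`** /
  **`aug_lawAt_snd`**: from `δ_{(x,T)}`, the configuration marginal of `P̂ⁿ` is `δ_x Pⁿ` and the subset marginal is
  `δ_T Rⁿ`.
* §2 **`aug_lawAt_support`** — THE TAG IS HONEST: `(δ_{(x,T)}P̂ⁿ)(z,V) ≠ 0 ⇒ V ⊆ T ∧ ∀ k ∈ V, z_k = x_k` (an untouched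
  coordinate still shows its initial value); `touch_lawAt_support` — `(δ_T Rⁿ)(V) ≠ 0 ⇒ V ⊆ T`.
* §3 **`lawAt_allMoved_le_touchEmpty` (THE GENEALOGICAL FLOOR)** — for every `x`, `T`, `n`:
  `(δ_x Pⁿ){z : ∀ k ∈ T, z_k ≠ x_k} ≤ (δ_T Rⁿ)(∅)`, and **`lawAt_someKept_ge`** —
  `(δ_x Pⁿ){z : ∃ k ∈ T, z_k = x_k} ≥ 1 − (δ_T Rⁿ)(∅)`.

Reading (no numerics implied): whatever the moves do when they fire, the chain cannot have changed every coordinate of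
`T` before every coordinate of `T` has been the target of some move; the right-hand side is a property of the move
SCHEDULE alone (which sets are proposed how often), bounded in the sequel by a second-moment (coupon-collector) estimate.
NOT CLAIMED: anything about acceptance, laws or maps (they enter only through locality); continuous time.  Literature
grade (cell rule): KNOWN MECHANISM (lumped chains, Levin–Peres–Wilmer Lemma 2.5; the "untouched coordinate" events of
the coupon-collector lower bounds, LPW §7.3), NEW TYPING; nothing cited as a fact; no new bib keys.
-/

noncomputable section

open Finset Function
open Literature.Probability.MarkovChains

namespace Summit.Ventures.LatticeQCDFlow.Scaling

variable {S L ι : Type*} [Fintype S] [DecidableEq S] [Fintype L] [DecidableEq L] [Fintype ι]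
  {c : ι → ℝ} {Pm : ι → (L → S) → (L → S) → ℝ} {τ : ι → Finset L}
  {P : (L → S) → (L → S) → ℝ} {R : Finset L → Finset L → ℝ}
  {Ph : (L → S) × Finset L → (L → S) × Finset L → ℝ}

/-! ## §1 The three kernels and the two lumpings -/

omit [DecidableEq S] in
/-- A mixture of transition matrices with probability weights is a transition matrix. [ours] -/
theorem mixture_isRowStochastic (hc : ∀ a, 0 ≤ c a) (hc1 : ∑ a, c a = 1)
    (hPm : ∀ a, IsRowStochastic (Pm a)) (hP : ∀ y z, P y z = ∑ a, c a * Pm a y z) : IsRowStochastic P := by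
  refine ⟨fun y z => ?_, fun y => ?_⟩
  · rw [hP]; exact sum_nonneg fun a _ => mul_nonneg (hc a) ((hPm a).1 y z)
  · simp_rw [hP]
    rw [sum_comm]
    simp_rw [← mul_sum, (hPm _).2, mul_one]
    exact hc1

omit [Fintype S] [DecidableEq S] in
/-- Summing the indicator `𝟙{V = U ∖ τ a}` over `V` gives `1`. [ours] -/
theorem sum_ite_eq_sdiff (U W : Finset L) : ∑ V : Finset L, (if V = U \ W then (1 : ℝ) else 0) = 1 := by
  rw [Finset.sum_ite_eq' univ (U \ W) (fun _ => (1 : ℝ)), if_pos (mem_univ _)]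

omit [Fintype S] [DecidableEq S] in
/-- The touch chain `R(U,V) = Σ_a c_a·𝟙{V = U ∖ τ a}` is a transition matrix. [ours] -/
theorem touch_isRowStochastic (hc : ∀ a, 0 ≤ c a) (hc1 : ∑ a, c a = 1)
    (hR : ∀ U V, R U V = ∑ a, c a * (if V = U \ τ a then (1 : ℝ) else 0)) : IsRowStochastic R := by
  refine ⟨fun U V => ?_, fun U => ?_⟩
  · rw [hR]; exact sum_nonneg fun a _ => mul_nonneg (hc a) (by split_ifs <;> norm_num)
  · simp_rw [hR]
    rw [sum_comm]
    simp_rw [← mul_sum, sum_ite_eq_sdiff, mul_one]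
    exact hc1

omit [DecidableEq S] in
/-- Fibre sums over the first projection of a product: `Σ_{q : q.1 = z} f q = Σ_V f (z, V)`. [ours] -/
theorem sum_filter_prodFst_eq {α β : Type*} [Fintype α] [DecidableEq α] [Fintype β] (f : α × β → ℝ) (z : α) :
    ∑ q ∈ univ.filter (fun q : α × β => q.1 = z), f q = ∑ b, f (z, b) := by
  rw [Finset.sum_filter, Fintype.sum_prod_type, Finset.sum_eq_single z]
  · exact sum_congr rfl fun b _ => if_pos rfl
  · intro a _ ha; exact sum_eq_zero fun b _ => if_neg ha
  · intro h; exact absurd (mem_univ _) h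

omit [DecidableEq S] in
/-- Fibre sums over the second projection of a product: `Σ_{q : q.2 = V} f q = Σ_z f (z, V)`. [ours] -/
theorem sum_filter_prodSnd_eq {α β : Type*} [Fintype α] [Fintype β] [DecidableEq β] (f : α × β → ℝ) (b : β) :
    ∑ q ∈ univ.filter (fun q : α × β => q.2 = b), f q = ∑ a, f (a, b) := by
  rw [Finset.sum_filter, Fintype.sum_prod_type]
  refine sum_congr rfl fun a _ => ?_
  rw [Finset.sum_eq_single b]
  · exact if_pos rfl
  · intro b' _ hb'; exact if_neg hb'
  · intro h; exact absurd (mem_univ _) h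

/-- **FIRST LUMPING: the configuration marginal of the augmented chain is the chain,**
`Σ_{q : q.1 = z} P̂(p, q) = P(p.1, z)`. [ours] -/
theorem aug_lump_fst (hP : ∀ y z, P y z = ∑ a, c a * Pm a y z)
    (hPh : ∀ p q, Ph p q = ∑ a, c a * (Pm a p.1 q.1 * if q.2 = p.2 \ τ a then (1 : ℝ) else 0))
    (p : (L → S) × Finset L) (z : L → S) :
    P p.1 z = ∑ q ∈ univ.filter (fun q : (L → S) × Finset L => q.1 = z), Ph p q := by
  rw [sum_filter_prodFst_eq, hP]
  simp_rw [hPh]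
  rw [sum_comm]
  refine sum_congr rfl fun a _ => ?_
  rw [← mul_sum]
  congr 1
  rw [← mul_sum, sum_ite_eq_sdiff, mul_one]

omit [DecidableEq S] in
/-- **SECOND LUMPING: the subset marginal of the augmented chain is the touch chain,**
`Σ_{q : q.2 = V} P̂(p, q) = R(p.2, V)` (every `Pm a` row-stochastic). [ours] -/
theorem aug_lump_snd (hPm : ∀ a, IsRowStochastic (Pm a))
    (hR : ∀ U V, R U V = ∑ a, c a * (if V = U \ τ a then (1 : ℝ) else 0))
    (hPh : ∀ p q, Ph p q = ∑ a, c a * (Pm a p.1 q.1 * if q.2 = p.2 \ τ a then (1 : ℝ) else 0))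
    (p : (L → S) × Finset L) (V : Finset L) :
    R p.2 V = ∑ q ∈ univ.filter (fun q : (L → S) × Finset L => q.2 = V), Ph p q := by
  rw [sum_filter_prodSnd_eq, hR]
  simp_rw [hPh]
  rw [sum_comm]
  refine sum_congr rfl fun a _ => ?_
  rw [← mul_sum]
  congr 1
  calc (if V = p.2 \ τ a then (1 : ℝ) else 0)
      = (∑ z : L → S, Pm a p.1 z) * (if V = p.2 \ τ a then (1 : ℝ) else 0) := by rw [(hPm a).2, one_mul]
    _ = ∑ z : L → S, Pm a p.1 z * (if V = p.2 \ τ a then (1 : ℝ) else 0) := Finset.sum_mul _ _ _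

/-- The augmented chain is a transition matrix. [ours] -/
theorem aug_isRowStochastic (hc : ∀ a, 0 ≤ c a) (hc1 : ∑ a, c a = 1) (hPm : ∀ a, IsRowStochastic (Pm a))
    (hP : ∀ y z, P y z = ∑ a, c a * Pm a y z)
    (hPh : ∀ p q, Ph p q = ∑ a, c a * (Pm a p.1 q.1 * if q.2 = p.2 \ τ a then (1 : ℝ) else 0)) :
    IsRowStochastic Ph := by
  refine ⟨fun p q => ?_, fun p => ?_⟩
  · rw [hPh]
    exact sum_nonneg fun a _ => mul_nonneg (hc a) (mul_nonneg ((hPm a).1 _ _) (by split_ifs <;> norm_num))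
  · rw [← Finset.sum_fiberwise univ Prod.fst (fun q => Ph p q)]
    have h : ∀ z, ∑ q ∈ univ.filter (fun q : (L → S) × Finset L => q.1 = z), Ph p q = P p.1 z :=
      fun z => (aug_lump_fst hP hPh p z).symm
    simp_rw [h]
    exact (mixture_isRowStochastic hc hc1 hPm hP).2 p.1

/-- The point mass at `(x, T)` projects to the point mass at `x`. [ours] -/
theorem sum_filter_prodFst_single (x : L → S) (T : Finset L) (z : L → S) :
    ∑ q ∈ univ.filter (fun q : (L → S) × Finset L => q.1 = z), (Pi.single (x, T) (1 : ℝ) : _ → ℝ) q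
      = (Pi.single x (1 : ℝ) : (L → S) → ℝ) z := by
  rw [sum_filter_prodFst_eq]
  by_cases hz : z = x
  · subst hz
    rw [Pi.single_eq_same, Finset.sum_eq_single T]
    · rw [Pi.single_eq_same]
    · intro V _ hV; rw [Pi.single_eq_of_ne (fun h => hV (Prod.mk.inj h).2)]
    · intro h; exact absurd (mem_univ _) h
  · rw [Pi.single_eq_of_ne hz]
    exact sum_eq_zero fun V _ => Pi.single_eq_of_ne (fun h => hz (Prod.mk.inj h).1) _

/-- The point mass at `(x, T)` projects to the point mass at `T`. [ours] -/
theorem sum_filter_prodSnd_single (x : L → S) (T : Finset L) (V : Finset L) :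
    ∑ q ∈ univ.filter (fun q : (L → S) × Finset L => q.2 = V), (Pi.single (x, T) (1 : ℝ) : _ → ℝ) q
      = (Pi.single T (1 : ℝ) : Finset L → ℝ) V := by
  rw [sum_filter_prodSnd_eq]
  by_cases hV : V = T
  · subst hV
    rw [Pi.single_eq_same, Finset.sum_eq_single x]
    · rw [Pi.single_eq_same]
    · intro z _ hz; rw [Pi.single_eq_of_ne (fun h => hz (Prod.mk.inj h).1)]
    · intro h; exact absurd (mem_univ _) h
  · rw [Pi.single_eq_of_ne hV]
    exact sum_eq_zero fun z _ => Pi.single_eq_of_ne (fun h => hV (Prod.mk.inj h).2) _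

/-- **The configuration marginal of `δ_{(x,T)} P̂ⁿ` is `δ_x Pⁿ`.** [ours] -/
theorem aug_lawAt_fst (hP : ∀ y z, P y z = ∑ a, c a * Pm a y z)
    (hPh : ∀ p q, Ph p q = ∑ a, c a * (Pm a p.1 q.1 * if q.2 = p.2 \ τ a then (1 : ℝ) else 0))
    (x : L → S) (T : Finset L) (n : ℕ) (z : L → S) :
    ∑ V : Finset L, lawAt Ph (Pi.single (x, T) 1) n (z, V) = lawAt P (Pi.single x 1) n z := by
  rw [← sum_filter_prodFst_eq (fun q => lawAt Ph (Pi.single (x, T) 1) n q) z,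
    LevinPeres2017_lemma_2_5_lawAt (P := Ph) (Ps := P) (proj := Prod.fst) (fun p z' => aug_lump_fst hP hPh p z')]
  congr 1
  funext z'
  exact sum_filter_prodFst_single x T z'

/-- **The subset marginal of `δ_{(x,T)} P̂ⁿ` is `δ_T Rⁿ`.** [ours] -/
theorem aug_lawAt_snd (hPm : ∀ a, IsRowStochastic (Pm a))
    (hR : ∀ U V, R U V = ∑ a, c a * (if V = U \ τ a then (1 : ℝ) else 0))
    (hPh : ∀ p q, Ph p q = ∑ a, c a * (Pm a p.1 q.1 * if q.2 = p.2 \ τ a then (1 : ℝ) else 0))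
    (x : L → S) (T : Finset L) (n : ℕ) (V : Finset L) :
    ∑ z : L → S, lawAt Ph (Pi.single (x, T) 1) n (z, V) = lawAt R (Pi.single T 1) n V := by
  rw [← sum_filter_prodSnd_eq (fun q => lawAt Ph (Pi.single (x, T) 1) n q) V,
    LevinPeres2017_lemma_2_5_lawAt (P := Ph) (Ps := R) (proj := Prod.snd) (fun p V' => aug_lump_snd hPm hR hPh p V')]
  congr 1
  funext V'
  exact sum_filter_prodSnd_single x T V'

/-! ## §2 The tag is honest -/

omit [Fintype S] [DecidableEq S] [Fintype L] in
/-- One step of the touch chain only removes coordinates: `R(U,V) ≠ 0 ⇒ V ⊆ U`. [ours] -/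
theorem touch_subset_of_ne_zero (hR : ∀ U V, R U V = ∑ a, c a * (if V = U \ τ a then (1 : ℝ) else 0))
    {U V : Finset L} (h : R U V ≠ 0) : V ⊆ U := by
  rw [hR] at h
  obtain ⟨a, -, ha⟩ := Finset.exists_ne_zero_of_sum_ne_zero h
  have hV : V = U \ τ a := by
    by_contra hne; rw [if_neg hne, mul_zero] at ha; exact ha rfl
  rw [hV]; exact sdiff_subset

omit [Fintype S] [DecidableEq S] in
/-- The touch chain started at `T` lives on the subsets of `T`: `(δ_T Rⁿ)(V) ≠ 0 ⇒ V ⊆ T`. [ours] -/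
theorem touch_lawAt_support (hR : ∀ U V, R U V = ∑ a, c a * (if V = U \ τ a then (1 : ℝ) else 0))
    (T : Finset L) : ∀ (n : ℕ) {V : Finset L}, lawAt R (Pi.single T 1) n V ≠ 0 → V ⊆ T := by
  intro n
  induction n with
  | zero =>
    intro V hV
    rw [lawAt_zero] at hV
    by_cases h : V = T
    · rw [h]
    · exact absurd (Pi.single_eq_of_ne h _) hV
  | succ n ih =>
    intro V hV
    rw [lawAt_succ] at hV
    obtain ⟨U, -, hU⟩ := Finset.exists_ne_zero_of_sum_ne_zero hV
    exact (touch_subset_of_ne_zero hR (right_ne_zero_of_mul hU)).trans (ih (left_ne_zero_of_mul hU))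

omit [Fintype S] [DecidableEq S] [Fintype L] in
/-- One step of the augmented chain: `P̂((y,U),(z,V)) ≠ 0 ⇒ V ⊆ U`, and the coordinates of `V` are not moved,
under locality. [ours] -/
theorem aug_step_support (hloc : ∀ a y z k, k ∉ τ a → Pm a y z ≠ 0 → z k = y k)
    (hPh : ∀ p q, Ph p q = ∑ a, c a * (Pm a p.1 q.1 * if q.2 = p.2 \ τ a then (1 : ℝ) else 0))
    {p q : (L → S) × Finset L} (h : Ph p q ≠ 0) : q.2 ⊆ p.2 ∧ ∀ k ∈ q.2, q.1 k = p.1 k := by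
  rw [hPh] at h
  obtain ⟨a, -, ha⟩ := Finset.exists_ne_zero_of_sum_ne_zero h
  have h2 := right_ne_zero_of_mul ha
  have hPa : Pm a p.1 q.1 ≠ 0 := left_ne_zero_of_mul h2
  have hV : q.2 = p.2 \ τ a := by
    by_contra hne; rw [if_neg hne, mul_zero] at h2; exact h2 rfl
  refine ⟨hV ▸ sdiff_subset, fun k hk => ?_⟩
  rw [hV, Finset.mem_sdiff] at hk
  exact hloc a p.1 q.1 k hk.2 hPa

/-- **THE TAG IS HONEST:** `(δ_{(x,T)} P̂ⁿ)(z,V) ≠ 0 ⇒ V ⊆ T ∧ ∀ k ∈ V, z_k = x_k` — a coordinate that no move has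
touched still shows its initial value. [ours] -/
theorem aug_lawAt_support (hloc : ∀ a y z k, k ∉ τ a → Pm a y z ≠ 0 → z k = y k)
    (hPh : ∀ p q, Ph p q = ∑ a, c a * (Pm a p.1 q.1 * if q.2 = p.2 \ τ a then (1 : ℝ) else 0))
    (x : L → S) (T : Finset L) :
    ∀ (n : ℕ) {q : (L → S) × Finset L}, lawAt Ph (Pi.single (x, T) 1) n q ≠ 0 →
      q.2 ⊆ T ∧ ∀ k ∈ q.2, q.1 k = x k := by
  intro n
  induction n with
  | zero =>
    intro q hq
    rw [lawAt_zero] at hq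
    by_cases h : q = (x, T)
    · subst h; exact ⟨subset_rfl, fun k _ => rfl⟩
    · exact absurd (Pi.single_eq_of_ne h _) hq
  | succ n ih =>
    intro q hq
    rw [lawAt_succ] at hq
    obtain ⟨p, -, hp⟩ := Finset.exists_ne_zero_of_sum_ne_zero hq
    have ihp := ih (left_ne_zero_of_mul hp)
    have hst := aug_step_support hloc hPh (right_ne_zero_of_mul hp)
    exact ⟨hst.1.trans ihp.1, fun k hk => (hst.2 k hk).trans (ihp.2 k (hst.1 hk))⟩

/-! ## §3 The genealogical floor -/

/-- **THE GENEALOGICAL FLOOR:** for every start `x`, every set of coordinates `T` and every time `n`,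
**`(δ_x Pⁿ){z : ∀ k ∈ T, z_k ≠ x_k} ≤ (δ_T Rⁿ)(∅)`** — the chain cannot have changed every coordinate of `T` before
the schedule has touched every coordinate of `T`. [ours] -/
theorem lawAt_allMoved_le_touchEmpty (hc : ∀ a, 0 ≤ c a) (hc1 : ∑ a, c a = 1)
    (hPm : ∀ a, IsRowStochastic (Pm a)) (hloc : ∀ a y z k, k ∉ τ a → Pm a y z ≠ 0 → z k = y k)
    (hP : ∀ y z, P y z = ∑ a, c a * Pm a y z)
    (hR : ∀ U V, R U V = ∑ a, c a * (if V = U \ τ a then (1 : ℝ) else 0))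
    (x : L → S) (T : Finset L) (n : ℕ) :
    ∑ z ∈ univ.filter (fun z : L → S => ∀ k ∈ T, z k ≠ x k), lawAt P (Pi.single x 1) n z
      ≤ lawAt R (Pi.single T 1) n ∅ := by
  -- the augmented chain, as an explicit kernel
  set Ph : (L → S) × Finset L → (L → S) × Finset L → ℝ :=
    fun p q => ∑ a, c a * (Pm a p.1 q.1 * if q.2 = p.2 \ τ a then (1 : ℝ) else 0) with hPh_def
  have hPh : ∀ p q, Ph p q = ∑ a, c a * (Pm a p.1 q.1 * if q.2 = p.2 \ τ a then (1 : ℝ) else 0) :=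
    fun p q => rfl
  have hnn : ∀ q, 0 ≤ lawAt Ph (Pi.single (x, T) 1) n q := fun q =>
    lawAt_nonneg (aug_isRowStochastic hc hc1 hPm hP hPh) (fun p => by
      by_cases h : p = (x, T)
      · subst h; rw [Pi.single_eq_same]; norm_num
      · rw [Pi.single_eq_of_ne h]) n q
  calc ∑ z ∈ univ.filter (fun z : L → S => ∀ k ∈ T, z k ≠ x k), lawAt P (Pi.single x 1) n z
      = ∑ z ∈ univ.filter (fun z : L → S => ∀ k ∈ T, z k ≠ x k),
          ∑ V : Finset L, lawAt Ph (Pi.single (x, T) 1) n (z, V) :=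
        sum_congr rfl fun z _ => (aug_lawAt_fst hP hPh x T n z).symm
    _ = ∑ z ∈ univ.filter (fun z : L → S => ∀ k ∈ T, z k ≠ x k), lawAt Ph (Pi.single (x, T) 1) n (z, ∅) := by
        refine sum_congr rfl fun z hz => ?_
        rw [Finset.sum_eq_single ∅]
        · intro V _ hV
          by_contra hne
          obtain ⟨k, hk⟩ := Finset.nonempty_iff_ne_empty.mpr hV
          have hsupp := aug_lawAt_support hloc hPh x T n hne
          exact (Finset.mem_filter.mp hz).2 k (hsupp.1 hk) (hsupp.2 k hk)
        · intro h; exact absurd (mem_univ _) h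
    _ ≤ ∑ z : L → S, lawAt Ph (Pi.single (x, T) 1) n (z, ∅) :=
        sum_le_univ_sum_of_nonneg fun z => hnn (z, ∅)
    _ = lawAt R (Pi.single T 1) n ∅ := aug_lawAt_snd hPm hR hPh x T n ∅

/-- **Complement form:** `(δ_x Pⁿ){z : ∃ k ∈ T, z_k = x_k} ≥ 1 − (δ_T Rⁿ)(∅)` — with probability at least the touch
chain's mass off `∅`, some coordinate of `T` still shows its initial value. [ours] -/
theorem lawAt_someKept_ge (hc : ∀ a, 0 ≤ c a) (hc1 : ∑ a, c a = 1)
    (hPm : ∀ a, IsRowStochastic (Pm a)) (hloc : ∀ a y z k, k ∉ τ a → Pm a y z ≠ 0 → z k = y k)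
    (hP : ∀ y z, P y z = ∑ a, c a * Pm a y z)
    (hR : ∀ U V, R U V = ∑ a, c a * (if V = U \ τ a then (1 : ℝ) else 0))
    (x : L → S) (T : Finset L) (n : ℕ) :
    1 - lawAt R (Pi.single T 1) n ∅
      ≤ ∑ z ∈ univ.filter (fun z : L → S => ∃ k ∈ T, z k = x k), lawAt P (Pi.single x 1) n z := by
  have hmass : ∑ z, lawAt P (Pi.single x 1) n z = 1 := by
    rw [sum_lawAt (mixture_isRowStochastic hc hc1 hPm hP), Finset.sum_pi_single', if_pos (mem_univ _)]
  have hsplit := Finset.sum_filter_add_sum_filter_not univ (fun z : L → S => ∃ k ∈ T, z k = x k)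
    (fun z => lawAt P (Pi.single x 1) n z)
  have hC : univ.filter (fun z : L → S => ¬∃ k ∈ T, z k = x k) = univ.filter (fun z : L → S => ∀ k ∈ T, z k ≠ x k) :=
    Finset.filter_congr fun z _ => by push Not; exact Iff.rfl
  rw [hmass, hC] at hsplit
  linarith [lawAt_allMoved_le_touchEmpty hc hc1 hPm hloc hP hR x T n]

end Summit.Ventures.LatticeQCDFlow.Scaling

end
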